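import Summits.NavierStokesRegularity.NavierStokesRegularity.Theses.TypeILiouville
import Summits.NavierStokesRegularity.NavierStokesRegularity.Theorems.TypeILiouvilleTypeIliouvilleLStubOseenConstBoost
import Summits.NavierStokesRegularity.NavierStokesRegularity.Theorems.SqueezeCycleExtremalElementExistsRegularity
import Summits.NavierStokesRegularity.NavierStokesRegularity.Theorems.TypeILiouvilleTypeIliouvilleLStubOseenGaugeUniformEverySlice
import Literature.Analysis.FluidPDE.TypeIAncientMild
import Literature.Analysis.FluidPDE.OseenBallAverageMomentum
import Literature.Analysis.FluidPDE.NSLerayBlowupRateLpProofs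
import Mathlib.MeasureTheory.Integral.Average
import HarnessLib

/-!
# Stub `stub_typeI_regime_of_knssGauge` (crux `TypeIliouvilleL`,
# stmt-NavierStokesRegularity-10661, line `registered`): the Type-I regime of the duality-form
# class from (L') in the KNSS gauge

Helper file (lands `--supports stmt-NavierStokesRegularity-10661`; theorems only, no definitions,
no named facts). Assume (i) the Oseen gauge theorem of the line (every bounded ancient mild
solution `u` of the duality-form class with a.e.-strongly measurable slices is, at every `t < 0`
and a.e. in space, a Galilean image `v(t, · − A(t)) + c(t)` of ONE bounded continuous ancient
solution `v` of the Oseen integral equation `v(t) = e^{(t−s)Δ}v(s) − B¹_s(v,v)(t)`), (ii)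
conservation of momentum at spatial infinity for bounded fields
(`⨍_{B_R} (e^{(t−s)Δ}V(s) − V(s) − B¹_s(V,V)(t)) → 0` as `R → ∞`) and (iii) the Type-I Liouville
statement (L') in the KNSS gauge (every jointly smooth, divergence-free, Oseen-mild ancient field
with `‖w(t,x)‖ ≤ C/√(−t)` vanishes). Then every `u` of the class with the Type-I time decay
`‖u(t,x)‖ ≤ C/√(−t)` (a.e. `x`, every `t < 0`) is a.e. constant on every slice
(`stub_typeI_regime_of_knssGauge`).

## Proof

1. `‖v(t) + c(t)‖ ≤ C/√(−t)` pointwise: an a.e. bound of the continuous field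
   `v(t, · − A t) + c t` holds everywhere (`forall_norm_le_of_ae_norm_le`).
2. Momentum: by (ii) and the Oseen identity of `v`, `⨍_{B_R}(v(t) − v(s)) → 0`, while
   `v(t) − v(s)` stays within `C/√(−t) + C/√(−s)` of `c(s) − c(t)`; hence
   `‖c(t) − c(s)‖ ≤ C/√(−t) + C/√(−s)` (`s < t < 0`).
3. So `n ↦ c(−(n+1))` is Cauchy; its limit `c_∞` has `‖c(t) − c_∞‖ ≤ C/√(−t)`, and
   `‖v(t) + c_∞‖ ≤ 2C/√(−t)` pointwise.
4. The constant Galilean boost `w(t, y) = v(t, y − t•c_∞) + c_∞` is a continuous bounded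
   Oseen-mild ancient field (`stub_oseen_const_boost`, landed) with the Type-I decay `2C`, hence
   a Type-I ancient mild field in the KNSS gauge (`isTypeIAncientMild_of_continuous_oseenMild`,
   `isTypeIAncientMild_iff`); (iii) gives `w ≡ 0`, i.e. `v ≡ −c_∞` on `(−∞,0) × ℝ³`, and
   `u(t) = c(t) − c_∞` a.e.

## References

* G. Koch, N. Nadirashvili, G. Seregin, V. Šverák, *Liouville theorems for the Navier–Stokes
  equations and applications*, Acta Math. 203 (2009) 83–105 = arXiv:0709.3599, §1 p. 3 (the
  parasitic solutions `b(t)`, conjecture (L), Type I bound (1.4)), §4 p. 8.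
  [KochNadirashviliSereginSverak2009]
* G. Seregin, V. Šverák, *On Type I singularities of the local axi-symmetric solutions of the
  Navier–Stokes equations*, Comm. PDE 34 (2009) = arXiv:0804.1803, §1 (1.1), (1.3).
  [SereginSverak2009]
-/

-- the summit and its single problem share the name (D-0017 nested layout)
set_option linter.dupNamespace false

noncomputable section

namespace Summit.NavierStokesRegularity.NavierStokesRegularity.Theorems

open MeasureTheory Filter Set Function Metric
open scoped Topology ENNReal
open Literature.Analysis Literature.Analysis.FluidPDE

namespace TypeIliouvilleL.TypeIRegimeOfKnssGauge

open TypeIliouvilleL.GaugeEverySlice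

/-! ### Step 1: a.e. bounds of continuous fields hold everywhere -/

/-- If `u₀ = V(· − a) + b` a.e. with `V` continuous and `‖u₀‖ ≤ M` a.e., then `‖V + b‖ ≤ M`
everywhere (an a.e. bound of a continuous field holds everywhere, `forall_norm_le_of_ae_norm_le`;
evaluate it at `y + a`). [folklore] -/
theorem norm_add_le_of_ae_rep {u₀ V : EuclideanSpace ℝ (Fin 3) → EuclideanSpace ℝ (Fin 3)}
    {a b : EuclideanSpace ℝ (Fin 3)} {M : ℝ} (hV : Continuous V)
    (hrep : u₀ =ᵐ[volume] fun x => V (x - a) + b)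
    (hdec : ∀ᵐ x ∂(volume : Measure (EuclideanSpace ℝ (Fin 3))), ‖u₀ x‖ ≤ M)
    (y : EuclideanSpace ℝ (Fin 3)) : ‖V y + b‖ ≤ M := by
  have hW : Continuous fun x => V (x - a) + b :=
    (hV.comp (continuous_id.sub continuous_const)).add continuous_const
  have hae : ∀ᵐ x ∂(volume : Measure (EuclideanSpace ℝ (Fin 3))), ‖V (x - a) + b‖ ≤ M := by
    filter_upwards [hrep, hdec] with x hx hd
    rw [← hx]
    exact hd
  have h := forall_norm_le_of_ae_norm_le hW hae (y + a)
  rwa [add_sub_cancel_right] at h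

/-! ### Step 2: oscillation of the parasitic drift from conservation of momentum -/

/-- **Oscillation of the parasitic drift, two-constant form.** If `‖V_t + b_t‖ ≤ M_t` and
`‖V_s + b_s‖ ≤ M_s` pointwise (`V_t`, `V_s` continuous) and the ball averages of `V_t − V_s` tend
to `0` as the radius tends to `∞` (conservation of momentum at infinity), then
`‖b_t − b_s‖ ≤ M_t + M_s`. [folklore] -/
theorem norm_sub_le_add_of_tendsto_setAverage
    {Vt Vs : EuclideanSpace ℝ (Fin 3) → EuclideanSpace ℝ (Fin 3)}
    {bt bs : EuclideanSpace ℝ (Fin 3)} {Mt Ms : ℝ}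
    (hVt : Continuous Vt) (hVs : Continuous Vs)
    (ht : ∀ y, ‖Vt y + bt‖ ≤ Mt) (hs : ∀ y, ‖Vs y + bs‖ ≤ Ms)
    (hmom : Tendsto (fun R : ℝ => ⨍ y in ball (0 : EuclideanSpace ℝ (Fin 3)) R, (Vt y - Vs y))
      atTop (𝓝 0)) :
    ‖bt - bs‖ ≤ Mt + Ms := by
  -- adapted from `TypeIliouvilleL.GaugeEverySlice.norm_sub_le_of_tendsto_setAverage`
  have hb : ∀ R : ℝ, 0 < R →
      ‖(⨍ y in ball (0 : EuclideanSpace ℝ (Fin 3)) R, (Vt y - Vs y)) - (bs - bt)‖ ≤ Mt + Ms := by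
    intro R hR
    refine norm_setAverage_ball_sub_le (hVt.sub hVs).aestronglyMeasurable (fun y => ?_) hR
    calc ‖Vt y - Vs y - (bs - bt)‖ = ‖(Vt y + bt) - (Vs y + bs)‖ := by congr 1; abel
      _ ≤ ‖Vt y + bt‖ + ‖Vs y + bs‖ := norm_sub_le _ _
      _ ≤ Mt + Ms := add_le_add (ht y) (hs y)
  have hlim : Tendsto (fun R : ℝ =>
      ‖(⨍ y in ball (0 : EuclideanSpace ℝ (Fin 3)) R, (Vt y - Vs y)) - (bs - bt)‖) atTop
      (𝓝 ‖(0 : EuclideanSpace ℝ (Fin 3)) - (bs - bt)‖) := (hmom.sub_const _).norm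
  have h := le_of_tendsto hlim ((eventually_gt_atTop 0).mono hb)
  rwa [zero_sub, norm_neg, norm_sub_rev] at h

/-! ### Step 3: the parasitic drift converges backward in time -/

/-- **Backward limit of the parasitic drift.** If `‖c(t) − c(s)‖ ≤ C/√(−t) + C/√(−s)` for all
`s < t < 0` and `0 ≤ C`, then there is `c_∞` with `‖c(t) − c_∞‖ ≤ C/√(−t)` for every `t < 0`
(the sequence `c(−(n+1))` is Cauchy; pass to the limit in the two-time bound). [folklore] -/
theorem exists_backward_limit {c : ℝ → EuclideanSpace ℝ (Fin 3)} {C : ℝ} (hC : 0 ≤ C)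
    (h2 : ∀ s t : ℝ, s < t → t < 0 → ‖c t - c s‖ ≤ C / Real.sqrt (-t) + C / Real.sqrt (-s)) :
    ∃ cinf : EuclideanSpace ℝ (Fin 3), ∀ t < 0, ‖c t - cinf‖ ≤ C / Real.sqrt (-t) := by
  -- `C/√(n+1) → 0`
  have hb0 : Tendsto (fun n : ℕ => C / Real.sqrt ((n : ℝ) + 1)) atTop (𝓝 0) :=
    tendsto_const_nhds.div_atTop (Real.tendsto_sqrt_atTop.comp
      (tendsto_atTop_add_const_right _ _ tendsto_natCast_atTop_atTop))
  -- the sequence `c(−(n+1))` is Cauchy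
  have hdist : ∀ n m : ℕ, n ≤ m →
      dist (c (-((n : ℝ) + 1))) (c (-((m : ℝ) + 1))) ≤ 2 * (C / Real.sqrt ((n : ℝ) + 1)) := by
    intro n m hnm
    rcases hnm.eq_or_lt with rfl | hlt
    · rw [dist_self]; positivity
    · have hnm' : (n : ℝ) < m := Nat.cast_lt.2 hlt
      have hst : -((m : ℝ) + 1) < -((n : ℝ) + 1) := by linarith
      have hn0 : -((n : ℝ) + 1) < 0 := by linarith [n.cast_nonneg (α := ℝ)]
      have h := h2 _ _ hst hn0
      rw [neg_neg, neg_neg] at h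
      have hsq : Real.sqrt ((n : ℝ) + 1) ≤ Real.sqrt ((m : ℝ) + 1) :=
        Real.sqrt_le_sqrt (by linarith)
      have hpos : 0 < Real.sqrt ((n : ℝ) + 1) := Real.sqrt_pos.2 (by positivity)
      rw [dist_eq_norm]
      calc ‖c (-((n : ℝ) + 1)) - c (-((m : ℝ) + 1))‖
          ≤ C / Real.sqrt ((n : ℝ) + 1) + C / Real.sqrt ((m : ℝ) + 1) := h
        _ ≤ C / Real.sqrt ((n : ℝ) + 1) + C / Real.sqrt ((n : ℝ) + 1) :=
          add_le_add le_rfl (div_le_div_of_nonneg_left hC hpos hsq)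
        _ = 2 * (C / Real.sqrt ((n : ℝ) + 1)) := by ring
  have hb2 : Tendsto (fun n : ℕ => 2 * (C / Real.sqrt ((n : ℝ) + 1))) atTop (𝓝 0) := by
    have h := hb0.const_mul 2
    rwa [mul_zero] at h
  have hcauchy : CauchySeq fun n : ℕ => c (-((n : ℝ) + 1)) :=
    cauchySeq_of_le_tendsto_0' (fun n : ℕ => 2 * (C / Real.sqrt ((n : ℝ) + 1))) hdist hb2
  obtain ⟨cinf, hcinf⟩ := cauchySeq_tendsto_of_complete hcauchy
  refine ⟨cinf, fun t ht => ?_⟩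
  -- pass to the limit `m → ∞` in `‖c t − c(−(m+1))‖ ≤ C/√(−t) + C/√(m+1)`
  have hlim1 : Tendsto (fun m : ℕ => ‖c t - c (-((m : ℝ) + 1))‖) atTop (𝓝 ‖c t - cinf‖) :=
    (tendsto_const_nhds.sub hcinf).norm
  have hlim2 : Tendsto (fun m : ℕ => C / Real.sqrt (-t) + C / Real.sqrt ((m : ℝ) + 1)) atTop
      (𝓝 (C / Real.sqrt (-t))) := by
    have h := hb0.const_add (C / Real.sqrt (-t))
    rwa [add_zero] at h
  refine le_of_tendsto_of_tendsto hlim1 hlim2 ?_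
  obtain ⟨N, hN⟩ := exists_nat_gt (-t)
  filter_upwards [eventually_ge_atTop N] with m hm
  have hNm : (N : ℝ) ≤ m := Nat.cast_le.2 hm
  have hmt : -((m : ℝ) + 1) < t := by linarith
  have h := h2 _ _ hmt ht
  rwa [neg_neg] at h

end TypeIliouvilleL.TypeIRegimeOfKnssGauge

open TypeIliouvilleL.TypeIRegimeOfKnssGauge in
/-- **Stub S1-red (the Type-I regime of the duality-form class from (L') in the KNSS gauge).**
Given (i) the Oseen gauge theorem for the slice-wise class (every bounded ancient mild solution
with a.e.-strongly measurable slices is, at every `t < 0` and a.e. in space, a Galilean image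
`v(t, · − A(t)) + c(t)` of one bounded continuous ancient Oseen-mild `v`), (ii) conservation of
momentum at infinity and (iii) the Type-I Liouville statement (L') in the KNSS gauge, every
bounded ancient mild solution with the Type-I time decay `‖u(t,x)‖ ≤ C/√(−t)` (a.e. `x`, every
`t < 0`) is a.e. constant on every slice. Route: `‖v(t) + c(t)‖ ≤ C/√(−t)` pointwise; by (ii)
`‖c(t) − c(s)‖ ≤ C/√(−t) + C/√(−s)`, so `c(t) → c_∞` as `t → −∞` with
`‖c(t) − c_∞‖ ≤ C/√(−t)`; the constant boost `w(t,y) = v(t, y − t•c_∞) + c_∞`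
(`stub_oseen_const_boost`) is a continuous bounded Oseen-mild ancient field with
`‖w(t)‖ ≤ 2C/√(−t)`, hence a Type-I ancient mild field in the KNSS gauge
(`isTypeIAncientMild_of_continuous_oseenMild`, `isTypeIAncientMild_iff`); (iii) gives `w ≡ 0`,
i.e. `v ≡ −c_∞`, and `u(t) = c(t) − c_∞` a.e. (the parasitic solutions `b(t)` of KNSS 2009 §1
are the only Type-I members of the duality-form class modulo (L')). [cite: KochNadirashviliSereginSverak2009, §1 p. 3 (parasitic solutions b(t), conjecture (L), Type I bound (1.4)) and §4 p. 8 (arXiv:0709.3599)] -/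
theorem stub_typeI_regime_of_knssGauge :
    (∀ u : ℝ → EuclideanSpace ℝ (Fin 3) → EuclideanSpace ℝ (Fin 3),
      Literature.Analysis.FluidPDE.IsBoundedAncientMildSolution 1 u →
      (∀ t < 0, AEStronglyMeasurable (u t) volume) →
      ∃ (v : ℝ → EuclideanSpace ℝ (Fin 3) → EuclideanSpace ℝ (Fin 3))
        (A c : ℝ → EuclideanSpace ℝ (Fin 3)),
        Measurable (uncurry v) ∧ ContinuousOn (uncurry v) (Iio 0 ×ˢ univ) ∧
        (∃ K : ℝ, ∀ t < 0, ∀ x, ‖v t x‖ ≤ K) ∧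
        (∀ t < 0, Literature.Analysis.FluidPDE.IsWeaklyDivFree (v t)) ∧
        (∀ s t : ℝ, s < t → t < 0 → ∀ x,
          v t x = Literature.Analysis.UnboundedOperators.heatExtension (v s) (t - s) x -
            Literature.Analysis.FluidPDE.oseenDuhamel 1 s v v t x) ∧
        Continuous A ∧
        ∀ t < 0, u t =ᵐ[volume] fun x => v t (x - A t) + c t) →
    (∀ (V : ℝ → EuclideanSpace ℝ (Fin 3) → EuclideanSpace ℝ (Fin 3)) (N s t : ℝ), s < t →
      Measurable (uncurry V) →
      (∀ σ ∈ Icc s t, ∀ y, ‖V σ y‖ ≤ N) →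
      Tendsto (fun R : ℝ => ⨍ x in Metric.ball (0 : EuclideanSpace ℝ (Fin 3)) R,
        (Literature.Analysis.UnboundedOperators.heatExtension (V s) (t - s) x - V s x -
          Literature.Analysis.FluidPDE.oseenDuhamel 1 s V V t x)) atTop (𝓝 0)) →
    (∀ (C : ℝ) (u : ℝ → EuclideanSpace ℝ (Fin 3) → EuclideanSpace ℝ (Fin 3)),
      ContDiffOn ℝ (⊤ : ℕ∞) (Function.uncurry u) (Set.Iio 0 ×ˢ Set.univ) ∧
      (∀ t < 0, Literature.Analysis.FluidPDE.VectorCalculus.IsDivFree (u t)) ∧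
      (∀ s t : ℝ, s < t → t < 0 → ∀ x,
        u t x = Literature.Analysis.FluidPDE.heatFlow (u s) (t - s) x -
          ∫ τ in Set.Ioo s t, ∫ y,
            Literature.Analysis.FluidPDE.oseenKernel (t - τ) (x - y) (u τ y) (u τ y)) ∧
      Literature.Analysis.FluidPDE.HasTypeITimeDecay C u →
      ∀ t < 0, ∀ x, u t x = 0) →
    ∀ u : ℝ → EuclideanSpace ℝ (Fin 3) → EuclideanSpace ℝ (Fin 3),
      Literature.Analysis.FluidPDE.IsBoundedAncientMildSolution 1 u →
      (∀ t < 0, AEStronglyMeasurable (u t) volume) →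
      (∃ C : ℝ, ∀ t < 0, ∀ᵐ x ∂(volume : Measure (EuclideanSpace ℝ (Fin 3))),
          ‖u t x‖ ≤ C / Real.sqrt (-t)) →
      ∀ t < 0, ∃ b : EuclideanSpace ℝ (Fin 3), u t =ᵐ[volume] fun _ => b := by
  intro hG hC hL u hu hmeas hdec t₀ ht₀
  obtain ⟨C, hCdec⟩ := hdec
  obtain ⟨v, A, c, hvm, hvc, ⟨K, hK⟩, hvd, hvmild, -, hrep⟩ := hG u hu hmeas
  -- slices of `v` are continuous
  have hvsl : ∀ t < 0, Continuous (v t) := fun t ht =>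
    hvc.comp_continuous (Continuous.prodMk_right t) fun y => ⟨ht, mem_univ y⟩
  -- Step 1: `‖v(t) + c(t)‖ ≤ C/√(−t)` everywhere
  have h1 : ∀ t < 0, ∀ y, ‖v t y + c t‖ ≤ C / Real.sqrt (-t) := fun t ht y =>
    norm_add_le_of_ae_rep (hvsl t ht) (hrep t ht) (hCdec t ht) y
  have hC0 : 0 ≤ C := by
    have h := h1 (-1) (by norm_num) 0
    rw [neg_neg, Real.sqrt_one, div_one] at h
    exact (norm_nonneg _).trans h
  -- Step 2: momentum, `‖c(t) − c(s)‖ ≤ C/√(−t) + C/√(−s)`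
  have h2 : ∀ s t : ℝ, s < t → t < 0 →
      ‖c t - c s‖ ≤ C / Real.sqrt (-t) + C / Real.sqrt (-s) := by
    intro s t hst ht
    have hs : s < 0 := hst.trans ht
    have hmom := hC v K s t hst hvm (fun σ hσ y => hK σ (hσ.2.trans_lt ht) y)
    have hint : ∀ y, Literature.Analysis.UnboundedOperators.heatExtension (v s) (t - s) y - v s y -
        oseenDuhamel 1 s v v t y = v t y - v s y := by
      intro y
      rw [hvmild s t hst ht y]
      abel
    have hmom' : Tendsto (fun R : ℝ => ⨍ y in ball (0 : EuclideanSpace ℝ (Fin 3)) R,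
        (v t y - v s y)) atTop (𝓝 0) := by
      refine hmom.congr fun R => ?_
      simp only [hint]
    exact norm_sub_le_add_of_tendsto_setAverage (hvsl t ht) (hvsl s hs) (h1 t ht) (h1 s hs) hmom'
  -- Step 3: the backward limit `c_∞` of the drift, `‖v(t) + c_∞‖ ≤ 2C/√(−t)`
  obtain ⟨cinf, h3⟩ := exists_backward_limit hC0 h2
  have h4 : ∀ t < 0, ∀ y, ‖v t y + cinf‖ ≤ 2 * C / Real.sqrt (-t) := by
    intro t ht y
    calc ‖v t y + cinf‖ = ‖(v t y + c t) - (c t - cinf)‖ := by congr 1; abel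
      _ ≤ ‖v t y + c t‖ + ‖c t - cinf‖ := norm_sub_le _ _
      _ ≤ C / Real.sqrt (-t) + C / Real.sqrt (-t) := add_le_add (h1 t ht y) (h3 t ht)
      _ = 2 * C / Real.sqrt (-t) := by ring
  -- Step 4: the constant boost by `−c_∞` is a Type-I ancient mild field in the KNSS gauge
  obtain ⟨hwc, -, hwd, hwm⟩ := stub_oseen_const_boost v (-cinf) hvc ⟨K, hK⟩ hvd hvmild
  have hwI : HasTypeITimeDecay (2 * C) (fun t y => v t (y + t • (-cinf)) - (-cinf)) := by
    intro t ht y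
    show ‖v t (y + t • (-cinf)) - (-cinf)‖ ≤ 2 * C / Real.sqrt (-t)
    rw [sub_neg_eq_add]
    exact h4 t ht _
  have hT : IsTypeIAncientMild (2 * C) (fun t y => v t (y + t • (-cinf)) - (-cinf)) :=
    isTypeIAncientMild_of_continuous_oseenMild hwc hwd hwm hwI
  have hzero := hL (2 * C) _ (isTypeIAncientMild_iff.1 hT)
  -- Step 5: unboost, `v ≡ −c_∞`
  have hv : ∀ t < 0, ∀ z, v t z = -cinf := by
    intro t ht z
    have h := hzero t ht (z - t • (-cinf))
    simp only [sub_add_cancel] at h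
    exact sub_eq_zero.1 h
  -- Step 6: the slice is a.e. the constant `c(t₀) − c_∞`
  have hfun : (fun x => v t₀ (x - A t₀) + c t₀) = fun _ => c t₀ - cinf := by
    funext x
    rw [hv t₀ ht₀]
    abel
  refine ⟨c t₀ - cinf, ?_⟩
  rw [← hfun]
  exact hrep t₀ ht₀

end Summit.NavierStokesRegularity.NavierStokesRegularity.Theorems

end
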